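import Mathlib
import Literature.NumberTheory.LFunctions.Zhang2022.Section2GammaFactor
import Literature.NumberTheory.Sieve.LargeSieveCharacters
import Literature.Analysis.SpecialFunctions.GammaProductBounds
import HarnessLib

/-!
# Zhang (2022), §2 (2.2): a crude polynomial bound for `Z(s,θ)` on `−3/4 ≤ σ ≤ −1/4`, all heights
# (input of the §6 outer-segment estimate, tex L1746), kernel-checked

Topic `Literature/NumberTheory/LFunctions/Zhang2022` (Landau–Siegel audit tree; verdict-neutral).
Y. Zhang, *Discrete mean estimates and the Landau–Siegel zero*, arXiv:2211.02515v1 (2022)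
[Zhang2022LandauSiegel] — **an unrefereed manuscript under adjudication; nothing here asserts or
denies its Theorems 1–2.** Campaign D-0069 (discharge lane, layer L2); THEOREM-ONLY.

§2 p. 4, (2.2): "`Z(s,θ) = τ(θ)π^{s−1/2}k^{−s}Γ((1−s)/2)/Γ(s/2)` if `θ(−1) = 1`, and
`Z(s,θ) = −iτ(θ)π^{s−1/2}k^{−s}Γ((2−s)/2)/Γ((1+s)/2)` if `θ(−1) = −1`" (the tree's `GammaFactor.Zfac`).
The §6 proof of (6.2) ("a trivial bound for `ω₁(w)` and simple estimates", tex L1746) needs a bound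
for `Z(s+w,ψ)` on the whole line `Re w = −1`, i.e. at `Re = σ − 1 ≈ −1/2` and EVERY height
(including `Im(s+w)` near `0`, where Stirling's formula is not available); this file supplies the
crude `‖Z(s,θ)‖ ≤ 120π²k²(1+|t|)³` there, straight from (2.2).

| decl | status |
|---|---|
| `norm_Gamma_le_of_re_mem` (private) | `‖Γ(a)‖ ≤ 32π²(1+|Im a|)²e^{−π|Im a|/2}` for `5/8 ≤ Re a ≤ 3/2` (shift `Γ(a) = Γ(a+1)/a` + the tree's `norm_Gamma_le_of_mem_Icc`) |
| `norm_Gamma_inv_le` (private) | `‖Γ(b)⁻¹‖ ≤ (15/2)‖b‖e^{π|Im b|/2}` for `1/2 ≤ Re b + 1 ≤ 5/2`, `b ≠ 0` (shift + the tree's `norm_Gamma_ge_exp`) |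
| `gamma_quotient_le` (private) | both Γ-quotients of (2.2) are `≤ 120π²(1+|t|)³` on `−3/4 ≤ σ ≤ −1/4` |
| `norm_Zfac_le_crude` | `‖Z(s,θ)‖ ≤ 120π²k²(1+|t|)³` for `θ` primitive mod `k`, `−3/4 ≤ σ ≤ −1/4`, all `t` |

No fact beyond Mathlib and the tree's Γ-bounds (FACT-LIST F-09) and `|τ(θ)|² = k` (F-07) is used.

## References

* Y. Zhang, arXiv:2211.02515v1 (2022), §2 (2.2) p. 4; §6 p. 32 (6.2).
  [cite: Zhang2022LandauSiegel, §2 (2.2) p.4]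
-/

noncomputable section

open Complex Real Set

namespace Literature.NumberTheory.LFunctions.Zhang2022.GammaFactor

open Literature.Analysis.SpecialFunctions (norm_Gamma_le_of_mem_Icc norm_Gamma_ge_exp)

/-! ## Two-sided bounds for `Γ` near the strip `0 ≤ Re ≤ 3/2` (all heights) -/

/-- `‖Γ(a)‖ ≤ 32π²(1+|Im a|)²e^{−π|Im a|/2}` for `5/8 ≤ Re a ≤ 3/2` and every `Im a` (for `Re a < 1`
via `Γ(a) = Γ(a+1)/a`, `|a| ≥ 5/8`; the tree's `norm_Gamma_le_of_mem_Icc` on `1 ≤ Re ≤ 2`).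
[folklore] -/
private theorem norm_Gamma_le_of_re_mem {a : ℂ} (h1 : 5 / 8 ≤ a.re) (h2 : a.re ≤ 3 / 2) :
    ‖Complex.Gamma a‖ ≤ 32 * π ^ 2 * (1 + |a.im|) ^ 2 * Real.exp (-(π * |a.im|) / 2) := by
  have hπ := Real.pi_pos
  have him0 : 0 ≤ |a.im| := abs_nonneg _
  -- `(1+|u|)^{3/2} ≤ (1+|u|)²`
  have hpow : ∀ u : ℝ, (1 + |u|) ^ (3 / 2 : ℝ) ≤ (1 + |u|) ^ 2 := by
    intro u
    have h1u : (1 : ℝ) ≤ 1 + |u| := by linarith [abs_nonneg u]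
    calc (1 + |u|) ^ (3 / 2 : ℝ) ≤ (1 + |u|) ^ ((2 : ℕ) : ℝ) :=
          Real.rpow_le_rpow_of_exponent_le h1u (by norm_num)
      _ = (1 + |u|) ^ 2 := Real.rpow_natCast _ _
  have hE : 0 ≤ Real.exp (-(π * |a.im|) / 2) := (Real.exp_pos _).le
  rcases lt_or_ge a.re 1 with hlt | hge
  · -- shift: `Γ(a) = Γ(a+1)/a`
    have ha0 : a ≠ 0 := by
      intro h; rw [h] at h1; simp at h1; linarith
    have hshift : Complex.Gamma a = Complex.Gamma (a + 1) / a := by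
      rw [Complex.Gamma_add_one a ha0]; field_simp
    have ha1 : a + 1 = (((a.re + 1 : ℝ)) : ℂ) + (a.im : ℂ) * I := by
      apply Complex.ext <;> simp
    have hG : ‖Complex.Gamma (a + 1)‖ ≤
        16 * π ^ 2 * (1 + |a.im|) ^ (3 / 2 : ℝ) * Real.exp (-(π * |a.im|) / 2) := by
      rw [ha1]; exact norm_Gamma_le_of_mem_Icc (by linarith) (by linarith) a.im
    have hnorm : 5 / 8 ≤ ‖a‖ := h1.trans (Complex.re_le_norm a)
    rw [hshift, norm_div]
    rw [div_le_iff₀ (by linarith)]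
    calc ‖Complex.Gamma (a + 1)‖
        ≤ 16 * π ^ 2 * (1 + |a.im|) ^ (3 / 2 : ℝ) * Real.exp (-(π * |a.im|) / 2) := hG
      _ ≤ 16 * π ^ 2 * (1 + |a.im|) ^ 2 * Real.exp (-(π * |a.im|) / 2) := by
          gcongr; exact hpow a.im
      _ = 32 * π ^ 2 * (1 + |a.im|) ^ 2 * Real.exp (-(π * |a.im|) / 2) * (1 / 2) := by ring
      _ ≤ 32 * π ^ 2 * (1 + |a.im|) ^ 2 * Real.exp (-(π * |a.im|) / 2) * ‖a‖ := by
          gcongr; linarith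
  · have ha : a = ((a.re : ℝ) : ℂ) + (a.im : ℂ) * I := (Complex.re_add_im a).symm
    have hG : ‖Complex.Gamma a‖ ≤
        16 * π ^ 2 * (1 + |a.im|) ^ (3 / 2 : ℝ) * Real.exp (-(π * |a.im|) / 2) := by
      rw [ha]; simpa using norm_Gamma_le_of_mem_Icc hge (by linarith) a.im
    calc ‖Complex.Gamma a‖
        ≤ 16 * π ^ 2 * (1 + |a.im|) ^ (3 / 2 : ℝ) * Real.exp (-(π * |a.im|) / 2) := hG
      _ ≤ 16 * π ^ 2 * (1 + |a.im|) ^ 2 * Real.exp (-(π * |a.im|) / 2) := by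
          gcongr; exact hpow a.im
      _ ≤ 32 * π ^ 2 * (1 + |a.im|) ^ 2 * Real.exp (-(π * |a.im|) / 2) := by
          gcongr; norm_num

/-- `‖Γ(b)⁻¹‖ ≤ (15/2)‖b‖e^{π|Im b|/2}` whenever `1/2 ≤ Re b + 1 ≤ 5/2` and `b ≠ 0` (via
`Γ(b) = Γ(b+1)/b` and the tree's lower bound `‖Γ(x+iy)‖ ≥ (2/15)e^{−π|y|/2}` on `1/2 ≤ x ≤ 5/2`).
[folklore] -/
private theorem norm_Gamma_inv_le {b : ℂ} (h1 : 1 / 2 ≤ b.re + 1) (h2 : b.re + 1 ≤ 5 / 2)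
    (hb0 : b ≠ 0) :
    ‖(Complex.Gamma b)⁻¹‖ ≤ 15 / 2 * ‖b‖ * Real.exp (π * |b.im| / 2) := by
  have hb1 : b + 1 = (((b.re + 1 : ℝ)) : ℂ) + (b.im : ℂ) * I := by
    apply Complex.ext <;> simp
  have hlow : 2 / 15 * Real.exp (-(π * |b.im|) / 2) ≤ ‖Complex.Gamma (b + 1)‖ := by
    rw [hb1]; exact norm_Gamma_ge_exp h1 h2 b.im
  have hE : 0 < Real.exp (-(π * |b.im|) / 2) := Real.exp_pos _
  have hpos : 0 < ‖Complex.Gamma (b + 1)‖ := lt_of_lt_of_le (by positivity) hlow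
  have hshift : (Complex.Gamma b)⁻¹ = b / Complex.Gamma (b + 1) := by
    rw [Complex.Gamma_add_one b hb0]
    have hG : Complex.Gamma b ≠ 0 := by
      intro h
      rw [Complex.Gamma_add_one b hb0, h, mul_zero, norm_zero] at hpos
      exact lt_irrefl _ hpos
    field_simp
  rw [hshift, norm_div, div_le_iff₀ hpos]
  have hee : Real.exp (π * |b.im| / 2) * Real.exp (-(π * |b.im|) / 2) = 1 := by
    rw [← Real.exp_add]; convert Real.exp_zero using 2; ring
  calc ‖b‖ = 15 / 2 * ‖b‖ * (Real.exp (π * |b.im| / 2) * (2 / 15 * Real.exp (-(π * |b.im|) / 2))) := by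
        rw [show Real.exp (π * |b.im| / 2) * (2 / 15 * Real.exp (-(π * |b.im|) / 2)) =
          2 / 15 * (Real.exp (π * |b.im| / 2) * Real.exp (-(π * |b.im|) / 2)) by ring, hee]
        ring
    _ ≤ 15 / 2 * ‖b‖ * (Real.exp (π * |b.im| / 2) * ‖Complex.Gamma (b + 1)‖) := by
        gcongr
    _ = 15 / 2 * ‖b‖ * Real.exp (π * |b.im| / 2) * ‖Complex.Gamma (b + 1)‖ := by ring

/-- The Γ-quotient of (2.2): for `−3/4 ≤ σ ≤ −1/4` and any `t`, both
`‖Γ((1−s)/2)‖·‖Γ(s/2)⁻¹‖` and `‖Γ((2−s)/2)‖·‖Γ((1+s)/2)⁻¹‖` are `≤ 120π²(1+|t|)³`.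
[cite: Zhang2022LandauSiegel, §2 (2.2) p.4] -/
private theorem gamma_quotient_le {s : ℂ} (h1 : -3 / 4 ≤ s.re) (h2 : s.re ≤ -1 / 4) (δ : ℝ)
    (hδ : δ = 0 ∨ δ = 1) :
    ‖Complex.Gamma ((1 + δ - s) / 2)‖ * ‖(Complex.Gamma ((δ + s) / 2))⁻¹‖ ≤
      120 * π ^ 2 * (1 + |s.im|) ^ 3 := by
  have hπ := Real.pi_pos
  set a : ℂ := (1 + δ - s) / 2 with ha
  set b : ℂ := (δ + s) / 2 with hb
  have hare : a.re = (1 + δ - s.re) / 2 := by simp [ha]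
  have haim : a.im = -s.im / 2 := by simp [ha]
  have hbre : b.re = (δ + s.re) / 2 := by simp [hb]
  have hbim : b.im = s.im / 2 := by simp [hb]
  have hδ01 : 0 ≤ δ ∧ δ ≤ 1 := by rcases hδ with h | h <;> subst h <;> norm_num
  have hA := norm_Gamma_le_of_re_mem (a := a) (by rw [hare]; rcases hδ with h | h <;> subst h <;> linarith)
    (by rw [hare]; rcases hδ with h | h <;> subst h <;> linarith)
  have hb0 : b ≠ 0 := by
    intro h
    have := congrArg Complex.re h
    rw [hbre, Complex.zero_re] at this
    rcases hδ with h' | h' <;> subst h' <;> linarith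
  have hB := norm_Gamma_inv_le (b := b) (by rw [hbre]; rcases hδ with h | h <;> subst h <;> linarith)
    (by rw [hbre]; rcases hδ with h | h <;> subst h <;> linarith) hb0
  rw [haim] at hA
  rw [hbim] at hB
  have habs1 : |(-s.im / 2)| = |s.im| / 2 := by rw [abs_div, abs_neg]; norm_num
  have habs2 : |s.im / 2| = |s.im| / 2 := by rw [abs_div]; norm_num
  rw [habs1] at hA
  rw [habs2] at hB
  -- `‖b‖ ≤ (1 + |t|)/2`
  have hbnorm : ‖b‖ ≤ (1 + |s.im|) / 2 := by
    calc ‖b‖ ≤ |b.re| + |b.im| := Complex.norm_le_abs_re_add_abs_im b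
      _ = |δ + s.re| / 2 + |s.im| / 2 := by rw [hbre, hbim, abs_div, abs_div]; norm_num
      _ ≤ 1 / 2 + |s.im| / 2 := by
          have : |δ + s.re| ≤ 1 := by
            rw [abs_le]; rcases hδ with h | h <;> subst h <;> constructor <;> linarith
          linarith
      _ = (1 + |s.im|) / 2 := by ring
  have ht0 : 0 ≤ |s.im| := abs_nonneg _
  have hee : Real.exp (-(π * (|s.im| / 2)) / 2) * Real.exp (π * (|s.im| / 2) / 2) = 1 := by
    rw [← Real.exp_add]; convert Real.exp_zero using 2; ring
  have hsq : (1 + |s.im| / 2) ^ 2 ≤ (1 + |s.im|) ^ 2 := by nlinarith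
  calc ‖Complex.Gamma a‖ * ‖(Complex.Gamma b)⁻¹‖
      ≤ (32 * π ^ 2 * (1 + |s.im| / 2) ^ 2 * Real.exp (-(π * (|s.im| / 2)) / 2)) *
          (15 / 2 * ‖b‖ * Real.exp (π * (|s.im| / 2) / 2)) :=
        mul_le_mul hA hB (norm_nonneg _) (by positivity)
    _ = 240 * π ^ 2 * (1 + |s.im| / 2) ^ 2 * ‖b‖ *
          (Real.exp (-(π * (|s.im| / 2)) / 2) * Real.exp (π * (|s.im| / 2) / 2)) := by ring
    _ = 240 * π ^ 2 * (1 + |s.im| / 2) ^ 2 * ‖b‖ := by rw [hee, mul_one]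
    _ ≤ 240 * π ^ 2 * (1 + |s.im|) ^ 2 * ((1 + |s.im|) / 2) := by gcongr
    _ = 120 * π ^ 2 * (1 + |s.im|) ^ 3 := by ring

/-- **A crude bound for `Z(s,θ)` left of the critical strip** (from the definition (2.2)): for a
primitive `θ (mod k)`, `−3/4 ≤ σ ≤ −1/4` and ANY real `t`, `‖Z(σ+it,θ)‖ ≤ 120π²k²(1+|t|)³`
(`|τ(θ)| = √k ≤ k`, `|π^{s−1/2}| ≤ 1`, `|k^{−s}| = k^{−σ} ≤ k`, and `gamma_quotient_le`).
[cite: Zhang2022LandauSiegel, §2 (2.2) p.4] -/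
theorem norm_Zfac_le_crude {k : ℕ} [NeZero k] {θ : DirichletCharacter ℂ k} (hθ : θ.IsPrimitive)
    {s : ℂ} (h1 : -3 / 4 ≤ s.re) (h2 : s.re ≤ -1 / 4) :
    ‖Zfac θ s‖ ≤ 120 * π ^ 2 * (k : ℝ) ^ 2 * (1 + |s.im|) ^ 3 := by
  have hπ := Real.pi_pos
  have hk1 : (1 : ℝ) ≤ k := by exact_mod_cast Nat.one_le_iff_ne_zero.mpr (NeZero.ne k)
  have hk0 : (0 : ℝ) < k := by linarith
  -- the scalar factors
  have hτ : ‖tau θ‖ ≤ k := by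
    have h := Sieve.LargeSieve.norm_gaussSum_sq hθ
    have hs : ‖tau θ‖ = Real.sqrt k := by
      rw [← Real.sqrt_sq (norm_nonneg (gaussSum θ (ZMod.stdAddChar (N := k)))), h]
    rw [hs]
    exact Real.sqrt_le_iff.mpr ⟨hk0.le, by nlinarith⟩
  have hπpow : ‖(π : ℂ) ^ (s - 1 / 2)‖ ≤ 1 := by
    rw [show (π : ℂ) = ((π : ℝ) : ℂ) by rfl, Complex.norm_cpow_eq_rpow_re_of_pos hπ]
    apply Real.rpow_le_one_of_one_le_of_nonpos (by linarith [Real.pi_gt_three])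
    simp; linarith
  have hkpow : ‖(k : ℂ) ^ (-s)‖ ≤ k := by
    rw [Complex.norm_natCast_cpow_of_pos (Nat.pos_of_ne_zero (NeZero.ne k))]
    calc (k : ℝ) ^ (-s).re ≤ (k : ℝ) ^ (1 : ℝ) :=
          Real.rpow_le_rpow_of_exponent_le hk1 (by simp; linarith)
      _ = k := Real.rpow_one _
  have hQ0 := gamma_quotient_le h1 h2 0 (Or.inl rfl)
  have hQ1 := gamma_quotient_le h1 h2 1 (Or.inr rfl)
  simp only [Complex.ofReal_zero, add_zero, zero_add, Complex.ofReal_one] at hQ0 hQ1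
  have hpoly : 0 ≤ 120 * π ^ 2 * (1 + |s.im|) ^ 3 := by positivity
  unfold Zfac
  split_ifs with hev
  · calc ‖tau θ * (π : ℂ) ^ (s - 1 / 2) * (k : ℂ) ^ (-s) *
          Complex.Gamma ((1 - s) / 2) * (Complex.Gamma (s / 2))⁻¹‖
        = ‖tau θ‖ * ‖(π : ℂ) ^ (s - 1 / 2)‖ * ‖(k : ℂ) ^ (-s)‖ *
            (‖Complex.Gamma ((1 - s) / 2)‖ * ‖(Complex.Gamma (s / 2))⁻¹‖) := by
          simp only [norm_mul]; ring
      _ ≤ k * 1 * k * (120 * π ^ 2 * (1 + |s.im|) ^ 3) := by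
          gcongr
      _ = 120 * π ^ 2 * (k : ℝ) ^ 2 * (1 + |s.im|) ^ 3 := by ring
  · have h2s : (2 : ℂ) - s = 1 + 1 - s := by norm_num
    calc ‖-I * tau θ * (π : ℂ) ^ (s - 1 / 2) * (k : ℂ) ^ (-s) *
          Complex.Gamma ((2 - s) / 2) * (Complex.Gamma ((1 + s) / 2))⁻¹‖
        = ‖tau θ‖ * ‖(π : ℂ) ^ (s - 1 / 2)‖ * ‖(k : ℂ) ^ (-s)‖ *
            (‖Complex.Gamma ((1 + 1 - s) / 2)‖ * ‖(Complex.Gamma ((1 + s) / 2))⁻¹‖) := by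
          rw [h2s]; simp only [norm_mul, norm_neg, Complex.norm_I, one_mul]; ring
      _ ≤ k * 1 * k * (120 * π ^ 2 * (1 + |s.im|) ^ 3) := by
          gcongr
      _ = 120 * π ^ 2 * (k : ℝ) ^ 2 * (1 + |s.im|) ^ 3 := by ring


end Literature.NumberTheory.LFunctions.Zhang2022.GammaFactor
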